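import Mathlib
import Summits.Ventures.PercRepro2.Defs
import Summits.Ventures.PercRepro2.Graph
import Summits.Ventures.PercRepro2.OneColourSwitch
import Summits.Ventures.PercRepro2.RegionHubSign
import Summits.Ventures.PercRepro2.SideSwitch
import Summits.Ventures.PercRepro2.SideSwitchFibre
import Summits.Ventures.PercRepro2.SideSwitchComps
import Summits.Ventures.PercRepro2.TermSwitchDefs
import Summits.Ventures.PercRepro2.TermSwitchReach
import Summits.Ventures.PercRepro2.M9NoPocketDefs
import Summits.Ventures.PercRepro2.M9NoPocketWorld
import Summits.Ventures.PercRepro2.M9NoPocketWorldD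
import Summits.Ventures.PercRepro2.M9NoPocketLegal
import Summits.Ventures.PercRepro2.M9NoPocketCompl
import Summits.Ventures.PercRepro2.M9GeneralDSplit

/-!
# The dirty points of the no-pocket fibration (blind cell PercRepro2, p3 g35, 2026-08-29;
`proofs/P3-NPHDR.md` §1)

In the fibration of `M9NoPocketFibre` the colours of the edges of `d` into the blocks are part
of the REPRESENTATIVE `ρ` (a block is switched with its `d`-edges).  A representative has a
DEAD edge when some block receives a `W` edge from `d` (`hasDead`), and a SOURCE when `d` has a
`T`-edge or some block receives a `Y` edge (`hasSource`).  Under the no-pocket hypothesis the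
hub–dead-end status of a point `assignX x ρ` (`x` legal) depends on `ρ` alone:
`HD (assignX x ρ) ↔ hasDead ρ ∧ hasSource ρ` (`HD_assignX_iff`) — a dead edge produces a
dead end on either side of the legal switch (`not_DZeroH_assignX_of_hasDead`), and without a
dead edge the worlds of the triple `{r, s, d}` are the worlds of `{r, s}` together with `d`
(`KH_triple_assignX_subset`, `MH_triple_assignX_subset`).  Both predicates are invariant
under the outside flip.  Own work; std axioms.
-/

namespace Summit.Ventures.PercRepro2

namespace NoPocket

open Finset Classical RegionHub OneColourSwitch SideSwitch TermSwitch

variable {V : Type*} {E : Type*}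

section Defs

variable [Fintype V] [DecidableEq V] [Fintype E] [DecidableEq E]

variable (ends : E → Sym2 V)

/-- The representative has a dead edge: some block receives a `W` edge from `d`. -/
def hasDead (d r s : V) (ρ : Config E) : Prop :=
  ∃ C ∈ blocks ends d r s ρ, hasW ends d ρ C

/-- The representative has a source for `d`: a `T`-edge, or some block receiving a `Y` edge. -/
def hasSource (d r s : V) (ρ : Config E) : Prop :=
  (Tset ends d r s).Nonempty ∨ ∃ C ∈ blocks ends d r s ρ, hasY ends d ρ C

variable {ends}

omit [Fintype E] [DecidableEq E] in
/-- `hasDead` is invariant under the outside flip. -/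
lemma hasDead_flipOp {d r s : V} (hr : d ≠ r) (hs : d ≠ s) (ρ : Config E) :
    hasDead ends d r s (flipOp ends d r s ρ) ↔ hasDead ends d r s ρ := by
  simp only [hasDead, blocks_flipOp hr hs]
  constructor
  · rintro ⟨C, hC, hW⟩
    exact ⟨C, hC, (hasW_flipOp hC).1 hW⟩
  · rintro ⟨C, hC, hW⟩
    exact ⟨C, hC, (hasW_flipOp hC).2 hW⟩

omit [DecidableEq E] in
/-- `hasSource` is invariant under the outside flip. -/
lemma hasSource_flipOp {d r s : V} (hr : d ≠ r) (hs : d ≠ s) (ρ : Config E) :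
    hasSource ends d r s (flipOp ends d r s ρ) ↔ hasSource ends d r s ρ := by
  simp only [hasSource, blocks_flipOp hr hs]
  constructor <;> rintro (h | ⟨C, hC, hY⟩)
  · exact Or.inl h
  · exact Or.inr ⟨C, hC, (hasY_flipOp hC).1 hY⟩
  · exact Or.inl h
  · exact Or.inr ⟨C, hC, (hasY_flipOp hC).2 hY⟩

end Defs

section Dirty

variable [Fintype V] [DecidableEq V] [Fintype E] [DecidableEq E] {ends : E → Sym2 V}

/-- `d` is reached in an assignment exactly when the representative has a source. -/
lemma reached_assignX_iff {p q r s d : V} (hnp : NoPocketAt ends d r s) (hr : d ≠ r)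
    (hs : d ≠ s) {ρ : Config E} (hρ : ρ ∈ RepD ends p q r s d)
    {x : Finset (Finset V) × Finset E} (hx : x ∈ L4 ends d r s ρ) :
    Reached ends r s d (assignX ends x ρ) ↔ hasSource ends d r s ρ := by
  obtain ⟨⟨hT, hF⟩, hLW, hLY⟩ := mem_L4.1 hx
  constructor
  · rintro (hK | hM)
    · rw [K2_assignX hnp hρ hT hF hr hs hLY] at hK
      rcases hK with hK | ⟨_, hsrc⟩
      · exact absurd hK (not_mem_K2_endsD hr hs _)
      · rcases hsrc with ⟨e, he, _⟩ | ⟨C, hC, _, hY⟩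
        · exact Or.inl ⟨e, he⟩
        · exact Or.inr ⟨C, hC, hY⟩
    · rw [M2_assignX hnp hρ hT hF hr hs hLW] at hM
      rcases hM with hM | ⟨_, hsrc⟩
      · exact absurd hM (not_mem_M2_endsD hr hs _)
      · rcases hsrc with ⟨e, _, he⟩ | ⟨C, hCx, hY⟩
        · exact Or.inl ⟨e, he⟩
        · exact Or.inr ⟨C, hT hCx, hY⟩
  · rintro (⟨e, he⟩ | ⟨C, hC, hY⟩)
    · by_cases hex : e ∈ x.2
      · exact Or.inr (d_mem_M2_of_srcW hρ hT hF hr hs (Or.inl ⟨e, hex, he⟩))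
      · exact Or.inl (d_mem_K2_of_srcY hρ hT hF hr hs (Or.inl ⟨e, he, hex⟩))
    · by_cases hCx : C ∈ x.1
      · exact Or.inr (d_mem_M2_of_srcW hρ hT hF hr hs (Or.inr ⟨C, hCx, hY⟩))
      · exact Or.inl (d_mem_K2_of_srcY hρ hT hF hr hs (Or.inr ⟨C, hC, hCx, hY⟩))

/-- **A dead edge produces a dead end**: with a dead edge in the representative, no legal
assignment is `DZero` for the triple `{r, s, d}`. -/
lemma not_DZeroH_assignX_of_hasDead {p q r s d : V} (hr : d ≠ r) (hs : d ≠ s) {ρ : Config E}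
    (hρ : ρ ∈ RepD ends p q r s d) {x : Finset (Finset V) × Finset E}
    (hx : x ∈ L4 ends d r s ρ) (hD : hasDead ends d r s ρ) :
    ¬ DZeroH ends ({r, s, d} : Set V) (assignX ends x ρ) := by
  obtain ⟨⟨hT, hF⟩, _, _⟩ := mem_L4.1 hx
  obtain ⟨C, hC, e, y, hy, hends, hρe⟩ := hD
  obtain ⟨hyr, hys, hyd⟩ := block_vertex_ne hρ hC hy hr hs
  intro hZ
  have hyH : y ∉ ({r, s, d} : Set V) := by
    simp only [Set.mem_insert_iff, Set.mem_singleton_iff, not_or]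
    exact ⟨hyr, hys, hyd⟩
  have hedge := assignX_block_edge hρ hT hF hr hs hC hy hends
  by_cases hCx : C ∈ x.1
  · -- the block is switched: the dead edge is now `Y`, `y` is in the `W`-world
    have hopen : assignX ends x ρ e = true := by
      rw [hedge, if_pos hCx, hρe]; rfl
    have hyM : y ∈ M2 ends r s (assignX ends x ρ) :=
      mem_M2_assignX_of_mem_unionT hρ hT hF (mem_unionT.2 ⟨C, hCx, hy⟩)
    have hyK : y ∈ KH ends ({r, s, d} : Set V) (assignX ends x ρ) :=
      mem_KH_triple'.2 (Or.inr (conn_of_openAdj ⟨e, hopen, hends⟩))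
    exact hZ y hyH hyK (mem_MH_triple'.2 (Or.inl hyM))
  · -- the block is not switched: the dead edge stays `W`, `y` is in the `Y`-world
    have hclosed : assignX ends x ρ e = false := by
      rw [hedge, if_neg hCx, hρe]
    have hyK : y ∈ K2 ends r s (assignX ends x ρ) :=
      mem_K2_assignX_of_block_notMem hρ hT hF hC hCx hy
    have hyM : y ∈ MH ends ({r, s, d} : Set V) (assignX ends x ρ) := by
      refine mem_MH_triple'.2 (Or.inr (conn_of_openAdj ⟨e, ?_, hends⟩))
      simp [OneColourSwitch.compl, hclosed]
    exact hZ y hyH (mem_KH_triple'.2 (Or.inl hyK)) hyM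

/-- Without a dead edge, the `Y`-world of the triple is the `Y`-world of `{r, s}` with `d`. -/
lemma KH_triple_assignX_subset {p q r s d : V} (hnp : NoPocketAt ends d r s) (hr : d ≠ r)
    (hs : d ≠ s) {ρ : Config E} (hρ : ρ ∈ RepD ends p q r s d)
    {x : Finset (Finset V) × Finset E} (hx : x ∈ L4 ends d r s ρ)
    (hD : ¬ hasDead ends d r s ρ) :
    KH ends ({r, s, d} : Set V) (assignX ends x ρ) ⊆
      K2 ends r s (assignX ends x ρ) ∪ {d} := by
  obtain ⟨⟨hT, hF⟩, _, _⟩ := mem_L4.1 hx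
  intro z hz
  rcases mem_KH_triple'.1 hz with hz | hz
  · exact Or.inl hz
  · -- the `Y`-cluster of `d` stays in `K₂ ∪ {d}`: closure under open adjacency
    refine mem_of_conn_of_closed (S := K2 ends r s (assignX ends x ρ) ∪ {d}) ?_
      (Or.inr rfl) hz
    rintro u (hu | hu) v hadj
    · obtain ⟨_, e, he, hends⟩ := openGraph_adj.1 hadj
      exact Or.inl (mem_K2_of_open hu he hends)
    · obtain ⟨hne, e, he, hends⟩ := openGraph_adj.1 hadj
      rw [Set.mem_singleton_iff] at hu
      rw [hu] at hends hne
      by_cases hvr : v = r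
      · rw [hvr]; exact Or.inl (r_mem_K2 r s _)
      by_cases hvs : v = s
      · rw [hvs]; exact Or.inl (s_mem_K2 r s _)
      have hvd : v ≠ d := fun h => hne h.symm
      have hA : v ∈ A0 (endsD ends d) r s ρ := by
        rcases neighbour_mem_worlds hnp hr hs ρ hends hvd hvr hvs with h | h
        · exact mem_A0.2 ⟨Or.inl h, hvr, hvs⟩
        · exact mem_A0.2 ⟨Or.inr h, hvr, hvs⟩
      obtain ⟨hC, hv⟩ := block_of_mem_A0 hA
      set C := compIn (endsD ends d) (↑(A0 (endsD ends d) r s ρ) : Set V) v with hCdef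
      have hρe : ρ e = true := by
        by_contra hρe
        exact hD ⟨C, hC, e, v, hv, hends, Bool.eq_false_iff.2 hρe⟩
      have hedge := assignX_block_edge hρ hT hF hr hs hC hv hends
      by_cases hCx : C ∈ x.1
      · rw [hedge, if_pos hCx, hρe] at he
        exact absurd he (by decide)
      · exact Or.inl (mem_K2_assignX_of_block_notMem hρ hT hF hC hCx hv)

/-- Without a dead edge, the `W`-world of the triple is the `W`-world of `{r, s}` with `d`. -/
lemma MH_triple_assignX_subset {p q r s d : V} (hnp : NoPocketAt ends d r s) (hr : d ≠ r)
    (hs : d ≠ s) {ρ : Config E} (hρ : ρ ∈ RepD ends p q r s d)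
    {x : Finset (Finset V) × Finset E} (hx : x ∈ L4 ends d r s ρ)
    (hD : ¬ hasDead ends d r s ρ) :
    MH ends ({r, s, d} : Set V) (assignX ends x ρ) ⊆
      M2 ends r s (assignX ends x ρ) ∪ {d} := by
  obtain ⟨⟨hT, hF⟩, _, _⟩ := mem_L4.1 hx
  intro z hz
  rcases mem_MH_triple'.1 hz with hz | hz
  · exact Or.inl hz
  · refine mem_of_conn_of_closed (S := M2 ends r s (assignX ends x ρ) ∪ {d}) ?_
      (Or.inr rfl) hz
    rintro u (hu | hu) v hadj
    · obtain ⟨_, e, he, hends⟩ := openGraph_adj.1 hadj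
      have he' : assignX ends x ρ e = false := by simpa [OneColourSwitch.compl] using he
      exact Or.inl (mem_M2_of_closed hu he' hends)
    · obtain ⟨hne, e, he, hends⟩ := openGraph_adj.1 hadj
      have he' : assignX ends x ρ e = false := by simpa [OneColourSwitch.compl] using he
      rw [Set.mem_singleton_iff] at hu
      rw [hu] at hends hne
      by_cases hvr : v = r
      · rw [hvr]; exact Or.inl (r_mem_M2 r s _)
      by_cases hvs : v = s
      · rw [hvs]; exact Or.inl (s_mem_M2 r s _)
      have hvd : v ≠ d := fun h => hne h.symm
      have hA : v ∈ A0 (endsD ends d) r s ρ := by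
        rcases neighbour_mem_worlds hnp hr hs ρ hends hvd hvr hvs with h | h
        · exact mem_A0.2 ⟨Or.inl h, hvr, hvs⟩
        · exact mem_A0.2 ⟨Or.inr h, hvr, hvs⟩
      obtain ⟨hC, hv⟩ := block_of_mem_A0 hA
      set C := compIn (endsD ends d) (↑(A0 (endsD ends d) r s ρ) : Set V) v with hCdef
      have hρe : ρ e = true := by
        by_contra hρe
        exact hD ⟨C, hC, e, v, hv, hends, Bool.eq_false_iff.2 hρe⟩
      have hedge := assignX_block_edge hρ hT hF hr hs hC hv hends
      by_cases hCx : C ∈ x.1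
      · exact Or.inl (mem_M2_assignX_of_mem_unionT hρ hT hF (mem_unionT.2 ⟨C, hCx, hv⟩))
      · rw [hedge, if_neg hCx, hρe] at he'
        exact absurd he' (by decide)

/-- **The dirty points of the no-pocket fibration**: a legal assignment is a hub–dead-end
point exactly when its representative has a dead edge and a source. -/
theorem HD_assignX_iff {p q r s d : V} (hnp : NoPocketAt ends d r s) (hpd : p ≠ d)
    (hqd : q ≠ d) (hr : d ≠ r) (hs : d ≠ s) {ρ : Config E} (hρ : ρ ∈ RepD ends p q r s d)
    {x : Finset (Finset V) × Finset E} (hx : x ∈ L4 ends d r s ρ) :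
    HD ends p q r s d (assignX ends x ρ) ↔ hasDead ends d r s ρ ∧ hasSource ends d r s ρ := by
  obtain ⟨hsep, hDOne⟩ := mem_DOneSet.1 (mem_DOneSet_assignX_of_mem_L4 hnp hpd hqd hr hs hρ hx)
  constructor
  · rintro ⟨_, _, hR, hL⟩
    refine ⟨?_, (reached_assignX_iff hnp hr hs hρ hx).1 hR⟩
    by_contra hD
    apply hL
    have hK := KH_triple_assignX_subset hnp hr hs hρ hx hD
    have hM := MH_triple_assignX_subset hnp hr hs hρ hx hD
    obtain ⟨hpK, hqK⟩ := not_mem_K2_of_sep2 hsep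
    obtain ⟨hpM, hqM⟩ := not_mem_M2_of_sep2 hsep
    refine ⟨⟨?_, ?_, ?_, ?_⟩, ?_⟩
    · intro h
      rcases hK h with h | h
      · exact hpK h
      · exact hpd h
    · intro h
      rcases hK h with h | h
      · exact hqK h
      · exact hqd h
    · intro h
      rcases hM h with h | h
      · exact hpM h
      · exact hpd h
    · intro h
      rcases hM h with h | h
      · exact hqM h
      · exact hqd h
    · intro z hzH hzK hzM
      simp only [Set.mem_insert_iff, Set.mem_singleton_iff, not_or] at hzH
      obtain ⟨hzr, hzs, hzd⟩ := hzH
      rcases hK hzK with hzK' | hzK'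
      · rcases hM hzM with hzM' | hzM'
        · exact hDOne z hzr hzs hzd hzK' hzM'
        · exact hzd hzM'
      · exact hzd hzK'
  · rintro ⟨hD, hS⟩
    exact ⟨hsep, hDOne, (reached_assignX_iff hnp hr hs hρ hx).2 hS,
      fun h => not_DZeroH_assignX_of_hasDead hr hs hρ hx hD h.2⟩

end Dirty

end NoPocket

end Summit.Ventures.PercRepro2
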